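import Mathlib
import HarnessLib
import Summits.HubbardSuperconductivity.HubbardSuperconductivity.Theorems.KLProgrammeKLRegimeEnginePairTransferKernelOfConserving

/-!
# Route `KLProgramme` — engine support (E1 docket row E-b1 (2′) / the TWO-LEG plain line): the momentum↔position dictionary at TWO legs — a conserving
# quadratic kernel `K(k₀,k₁) = κ·[k̄₀ = k̄₁]·f(k̄₀)` has plane-wave transform `conj u(x₀⁰)·u(x₀¹)·κ·(2M·L²)·Σ_Q χ̄_Q(x̄¹ − x̄⁰)·f(Q)`, so the
# two-leg PLAIN pinned line IS `ε_x·‖κ‖·Σ_z ‖Σ_Q χ̄_Q(z)•f(Q)‖` EXACTLY — any symbol-side `ℓ¹` bound (bumps: (T1); shells: the `ℓ²` master lemma) feeds it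

Cell gate-hubbard-kl, seat hubbard-kl-k3c2-p3 (g16).  Companion of (T5b)/(T7) (four legs).  The (ℓ)/(b)-WT4 import rows also carry a TWO-leg plain line
(`EngineV8.importRowsF_of_plainLines_klEng`: `fixedTupleL1 L M β 1 (sectorisedKernel … trivialMultiplier 𝒱 2) ((0,s),c') y₀ ≤ s₂·4^{−(dk−1)}·lam`; located «E-b1-2LEG-SHAPE»,
pen (R403): c-class counterterm residual + U-class generated remainder).  This file converts that line, for a conserving quadratic momentum kernel, into the
`ℓ¹` norm of ONE character sum of its symbol — with EQUALITY:

* **`planeWaveSum_two_eq_charSum_of_conserving`** — charges `(+,−)`: `Σ_k (∏_i e^{∓ik_i·x_i})·K k = conj u(x₀⁰)·u(x₀¹)·κ·Σ_Q χ̄_Q(x̄¹ − x̄⁰)·f(Q)`;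
* **`fixedTupleL1_two_eq_of_conserving`** — hence for ANY `𝒱` whose 2-kernel on `((k₀,σ₀),+),((k₁,σ₁),−)` is `κ·[k̄₀ = k̄₁]·f(k̄₀)`:
  `fixedTupleL1 L M β 1 (sectorisedKernel … trivialMultiplier 𝒱 2) ((0,σ i),![0,1] i) y = ε_x·‖κ‖·Σ_z ‖Σ_Q χ̄_Q(z)•f(Q)‖` (the pinned point drops out);
* with `f = Σ_s a_s G_s` a superposition of (T1)-bumps, `TorusFourierL2.sum_norm_charSum_superposition_le` (p704215) then gives `≤ ε_x·‖κ‖·√(10485760·n₀)·(2M·L²)·Σ_s‖a_s‖A_s`.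
(For shell-supported symbols — the frame/counterterm pieces — feed `TorusFourierL2.sum_norm_charSum_le_of_second_differences` instead of the bump lemma.)
Everything is proved; no definitions, no named facts; the kernel hypothesis is asserted for no engine object; nothing asserts E-b1, (b), any stub, K3 or
superconductivity. [folklore]  References: BGM 2006 §2.1, §2.3 (2.17) [cite: BenfattoGiulianiMastropietro2006]; Salmhofer 1999 §4.2.4.
-/

noncomputable section

namespace Summit.HubbardSuperconductivity.HubbardSuperconductivity.Theorems.TorusFourierL2

set_option linter.dupNamespace false -- summit = problem name (single-conjunct summit), D-0017

open Finset Complex Literature.Probability.LatticeModels Literature.MathematicalPhysics.QuantumLattice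
open Literature.MathematicalPhysics.QuantumLattice.GrassmannAlgebra
open Summit.HubbardSuperconductivity.HubbardSuperconductivity.Theorems.KLRegimeSplit
open scoped Real ComplexConjugate

variable {L M : ℕ} [NeZero L] [NeZero M]

omit [NeZero L] in
/-- A sum over `2`-tuples of frequency–momenta of a function of their torus images is a double sum over the product torus. [folklore] -/
theorem sum_tuple2_freqMomentum_eq [NeZero L] (F : (TorusSite 1 (2 * M) × TorusSite 2 L) → (TorusSite 1 (2 * M) × TorusSite 2 L) → ℂ) :
    ∑ k : Fin 2 → FreqMomentum L M, F ((fun _ : Fin 1 => (((k 0).1 : ℕ) : ZMod (2 * M))), (k 0).2) ((fun _ : Fin 1 => (((k 1).1 : ℕ) : ZMod (2 * M))), (k 1).2) = ∑ p₀ : TorusSite 1 (2 * M) × TorusSite 2 L, ∑ p₁ : TorusSite 1 (2 * M) × TorusSite 2 L, F p₀ p₁ := by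
  rw [sum_tuple_succ]
  have h1 : ∀ (X : FreqMomentum L M) (W : Fin 1 → FreqMomentum L M),
      F ((fun _ : Fin 1 => ((((Fin.cons X W : Fin 2 → FreqMomentum L M) 0).1 : ℕ) : ZMod (2 * M))), ((Fin.cons X W : Fin 2 → FreqMomentum L M) 0).2)
        ((fun _ : Fin 1 => ((((Fin.cons X W : Fin 2 → FreqMomentum L M) 1).1 : ℕ) : ZMod (2 * M))), ((Fin.cons X W : Fin 2 → FreqMomentum L M) 1).2) =
      F ((fun _ : Fin 1 => ((X.1 : ℕ) : ZMod (2 * M))), X.2) ((fun _ : Fin 1 => (((W 0).1 : ℕ) : ZMod (2 * M))), (W 0).2) := fun _ _ => rfl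
  rw [sum_congr rfl fun X _ => sum_congr rfl fun W _ => h1 X W]
  have h2 : ∀ X : FreqMomentum L M, ∑ W : Fin 1 → FreqMomentum L M,
      F ((fun _ : Fin 1 => ((X.1 : ℕ) : ZMod (2 * M))), X.2) ((fun _ : Fin 1 => (((W 0).1 : ℕ) : ZMod (2 * M))), (W 0).2) =
      ∑ X₁ : FreqMomentum L M, F ((fun _ : Fin 1 => ((X.1 : ℕ) : ZMod (2 * M))), X.2) ((fun _ : Fin 1 => ((X₁.1 : ℕ) : ZMod (2 * M))), X₁.2) := by
    intro X
    rw [sum_tuple_one]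
  simp_rw [h2]
  have e1 : ∀ a : TorusSite 1 (2 * M) × TorusSite 2 L, ∑ X₁ : FreqMomentum L M, F a ((fun _ : Fin 1 => ((X₁.1 : ℕ) : ZMod (2 * M))), X₁.2) = ∑ p₁ : TorusSite 1 (2 * M) × TorusSite 2 L, F a p₁ :=
    fun a => sum_freqMomentum_eq_sum_prodTorus (F a)
  simp_rw [e1]
  exact sum_freqMomentum_eq_sum_prodTorus (fun p₀ => ∑ p₁ : TorusSite 1 (2 * M) × TorusSite 2 L, F p₀ p₁)

/-- **The two-leg dictionary** (charges `(+,−)`): for `K k = κ·[k̄₀ = k̄₁]·f(k̄₀)`,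
`Σ_k (∏_i e^{∓ik_i·x_i})·K k = conj u(x₀⁰)·u(x₀¹)·κ·Σ_Q χ̄_Q(x̄¹ − x̄⁰)·f(Q)`. [cite: BenfattoGiulianiMastropietro2006, §2.3 (2.17)] -/
theorem planeWaveSum_two_eq_charSum_of_conserving {β : ℝ} (hβ : β ≠ 0) (σ : Fin 2 → Fin 2) (K : (Fin 2 → FreqMomentum L M) → ℂ)
    (κ : ℂ) (f : TorusSite 1 (2 * M) × TorusSite 2 L → ℂ) (hker : ∀ k : Fin 2 → FreqMomentum L M, K k = κ * (if ((fun _ : Fin 1 => (((k 0).1 : ℕ) : ZMod (2 * M))), (k 0).2) = (((fun _ : Fin 1 => (((k 1).1 : ℕ) : ZMod (2 * M))), (k 1).2) : TorusSite 1 (2 * M) × TorusSite 2 L) then f ((fun _ : Fin 1 => (((k 0).1 : ℕ) : ZMod (2 * M))), (k 0).2) else 0)) (x : Fin 2 → SpaceTimeIdx L M) :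
    ∑ k : Fin 2 → FreqMomentum L M, (∏ i, trivialMultiplier L M ((fun i : Fin 2 => ((((0 : Fin 1), σ i) : Fin 1 × Fin 2), (![0, 1] : Fin 2 → Fin 2) i)) i).1.1 (k i) * hubbardPlaneWave L M β ((fun i : Fin 2 => ((((0 : Fin 1), σ i) : Fin 1 × Fin 2), (![0, 1] : Fin 2 → Fin 2) i)) i).2 (k i) (x i)) * K k =
      conj (Complex.exp (((π * (1 - 2 * M) * (((x 0).1 : ℕ) : ℝ) / (2 * M) : ℝ) : ℂ) * I)) * Complex.exp (((π * (1 - 2 * M) * (((x 1).1 : ℕ) : ℝ) / (2 * M) : ℝ) : ℂ) * I) * κ *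
        ∑ Q : TorusSite 1 (2 * M) × TorusSite 2 L, (torusChar (Q).1 ((((fun _ : Fin 1 => (((x 1).1 : ℕ) : ZMod (2 * M))), (x 1).2) : TorusSite 1 (2 * M) × TorusSite 2 L) - (((fun _ : Fin 1 => (((x 0).1 : ℕ) : ZMod (2 * M))), (x 0).2) : TorusSite 1 (2 * M) × TorusSite 2 L)).1 * torusChar (Q).2 ((((fun _ : Fin 1 => (((x 1).1 : ℕ) : ZMod (2 * M))), (x 1).2) : TorusSite 1 (2 * M) × TorusSite 2 L) - (((fun _ : Fin 1 => (((x 0).1 : ℕ) : ZMod (2 * M))), (x 0).2) : TorusSite 1 (2 * M) × TorusSite 2 L)).2) * f Q := by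
  classical
  have ht : ∀ (ω : Fin 1) (q : FreqMomentum L M), trivialMultiplier L M ω q = 1 := fun _ _ => rfl
  have hterm : ∀ k : Fin 2 → FreqMomentum L M, (∏ i, trivialMultiplier L M ((fun i : Fin 2 => ((((0 : Fin 1), σ i) : Fin 1 × Fin 2), (![0, 1] : Fin 2 → Fin 2) i)) i).1.1 (k i) * hubbardPlaneWave L M β ((fun i : Fin 2 => ((((0 : Fin 1), σ i) : Fin 1 × Fin 2), (![0, 1] : Fin 2 → Fin 2) i)) i).2 (k i) (x i)) * K k =
      (conj (Complex.exp (((π * (1 - 2 * M) * (((x 0).1 : ℕ) : ℝ) / (2 * M) : ℝ) : ℂ) * I)) * Complex.exp (((π * (1 - 2 * M) * (((x 1).1 : ℕ) : ℝ) / (2 * M) : ℝ) : ℂ) * I) * κ) *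
        ((torusChar (((fun _ : Fin 1 => (((k 0).1 : ℕ) : ZMod (2 * M))), (k 0).2)).1 (-(((fun _ : Fin 1 => (((x 0).1 : ℕ) : ZMod (2 * M))), (x 0).2) : TorusSite 1 (2 * M) × TorusSite 2 L)).1 * torusChar (((fun _ : Fin 1 => (((k 0).1 : ℕ) : ZMod (2 * M))), (k 0).2)).2 (-(((fun _ : Fin 1 => (((x 0).1 : ℕ) : ZMod (2 * M))), (x 0).2) : TorusSite 1 (2 * M) × TorusSite 2 L)).2) * (torusChar (((fun _ : Fin 1 => (((k 1).1 : ℕ) : ZMod (2 * M))), (k 1).2)).1 ((((fun _ : Fin 1 => (((x 1).1 : ℕ) : ZMod (2 * M))), (x 1).2) : TorusSite 1 (2 * M) × TorusSite 2 L)).1 * torusChar (((fun _ : Fin 1 => (((k 1).1 : ℕ) : ZMod (2 * M))), (k 1).2)).2 ((((fun _ : Fin 1 => (((x 1).1 : ℕ) : ZMod (2 * M))), (x 1).2) : TorusSite 1 (2 * M) × TorusSite 2 L)).2) * (if ((fun _ : Fin 1 => (((k 0).1 : ℕ) : ZMod (2 * M))), (k 0).2) = (((fun _ : Fin 1 =>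 (((k 1).1 : ℕ) : ZMod (2 * M))), (k 1).2) : TorusSite 1 (2 * M) × TorusSite 2 L) then f ((fun _ : Fin 1 => (((k 0).1 : ℕ) : ZMod (2 * M))), (k 0).2) else 0)) := by
    intro k
    rw [hker k, Fin.prod_univ_two]
    simp only [ht, one_mul]
    show hubbardPlaneWave L M β 0 (k 0) (x 0) * hubbardPlaneWave L M β 1 (k 1) (x 1) * (κ * (if ((fun _ : Fin 1 => (((k 0).1 : ℕ) : ZMod (2 * M))), (k 0).2) = (((fun _ : Fin 1 => (((k 1).1 : ℕ) : ZMod (2 * M))), (k 1).2) : TorusSite 1 (2 * M) × TorusSite 2 L) then f ((fun _ : Fin 1 => (((k 0).1 : ℕ) : ZMod (2 * M))), (k 0).2) else 0)) = _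
    rw [hubbardPlaneWave_zero_eq_phase_mul_pchar hβ, hubbardPlaneWave_one_eq_phase_mul_pchar hβ]
    simp only [Prod.fst_neg, Prod.snd_neg]
    ring
  simp_rw [hterm]
  rw [← mul_sum]
  congr 1
  have hsum2 : ∑ k : Fin 2 → FreqMomentum L M, (torusChar (((fun _ : Fin 1 => (((k 0).1 : ℕ) : ZMod (2 * M))), (k 0).2)).1 (-(((fun _ : Fin 1 => (((x 0).1 : ℕ) : ZMod (2 * M))), (x 0).2) : TorusSite 1 (2 * M) × TorusSite 2 L)).1 * torusChar (((fun _ : Fin 1 => (((k 0).1 : ℕ) : ZMod (2 * M))), (k 0).2)).2 (-(((fun _ : Fin 1 => (((x 0).1 : ℕ) : ZMod (2 * M))), (x 0).2) : TorusSite 1 (2 * M) × TorusSite 2 L)).2) * (torusChar (((fun _ : Fin 1 => (((k 1).1 : ℕ) : ZMod (2 * M))), (k 1).2)).1 ((((fun _ : Fin 1 => (((x 1).1 : ℕ) : ZMod (2 * M))), (x 1).2) : TorusSite 1 (2 * M) × TorusSite 2 L)).1 * torusChar (((fun _ : Fin 1 => (((k 1).1 : ℕ) : ZMod (2 * M))),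 (k 1).2)).2 ((((fun _ : Fin 1 => (((x 1).1 : ℕ) : ZMod (2 * M))), (x 1).2) : TorusSite 1 (2 * M) × TorusSite 2 L)).2) * (if ((fun _ : Fin 1 => (((k 0).1 : ℕ) : ZMod (2 * M))), (k 0).2) = (((fun _ : Fin 1 => (((k 1).1 : ℕ) : ZMod (2 * M))), (k 1).2) : TorusSite 1 (2 * M) × TorusSite 2 L) then f ((fun _ : Fin 1 => (((k 0).1 : ℕ) : ZMod (2 * M))), (k 0).2) else 0) =
      ∑ p₀ : TorusSite 1 (2 * M) × TorusSite 2 L, ∑ p₁ : TorusSite 1 (2 * M) × TorusSite 2 L, (torusChar (p₀).1 (-(((fun _ : Fin 1 => (((x 0).1 : ℕ) : ZMod (2 * M))), (x 0).2) : TorusSite 1 (2 * M) × TorusSite 2 L)).1 * torusChar (p₀).2 (-(((fun _ : Fin 1 => (((x 0).1 : ℕ) : ZMod (2 * M))), (x 0).2) : TorusSite 1 (2 * M) × TorusSite 2 L)).2) * (torusChar (p₁).1 ((((fun _ : Fin 1 => (((x 1).1 : ℕ) : ZMod (2 * M))), (x 1).2) : TorusSite 1 (2 * M) × TorusSite 2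 L)).1 * torusChar (p₁).2 ((((fun _ : Fin 1 => (((x 1).1 : ℕ) : ZMod (2 * M))), (x 1).2) : TorusSite 1 (2 * M) × TorusSite 2 L)).2) * (if p₀ = p₁ then f p₀ else 0) :=
    sum_tuple2_freqMomentum_eq (fun p₀ p₁ => (torusChar (p₀).1 (-(((fun _ : Fin 1 => (((x 0).1 : ℕ) : ZMod (2 * M))), (x 0).2) : TorusSite 1 (2 * M) × TorusSite 2 L)).1 * torusChar (p₀).2 (-(((fun _ : Fin 1 => (((x 0).1 : ℕ) : ZMod (2 * M))), (x 0).2) : TorusSite 1 (2 * M) × TorusSite 2 L)).2) * (torusChar (p₁).1 ((((fun _ : Fin 1 => (((x 1).1 : ℕ) : ZMod (2 * M))), (x 1).2) : TorusSite 1 (2 * M) × TorusSite 2 L)).1 * torusChar (p₁).2 ((((fun _ : Fin 1 => (((x 1).1 : ℕ) : ZMod (2 * M))), (x 1).2) : TorusSite 1 (2 * M) × TorusSite 2 L)).2) * (if p₀ = p₁ then f p₀ else 0))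
  rw [hsum2]
  -- the second leg is forced: `p₁ = p₀`
  have hin : ∀ p₀ : TorusSite 1 (2 * M) × TorusSite 2 L, ∑ p₁ : TorusSite 1 (2 * M) × TorusSite 2 L, (torusChar (p₀).1 (-(((fun _ : Fin 1 => (((x 0).1 : ℕ) : ZMod (2 * M))), (x 0).2) : TorusSite 1 (2 * M) × TorusSite 2 L)).1 * torusChar (p₀).2 (-(((fun _ : Fin 1 => (((x 0).1 : ℕ) : ZMod (2 * M))), (x 0).2) : TorusSite 1 (2 * M) × TorusSite 2 L)).2) * (torusChar (p₁).1 ((((fun _ : Fin 1 => (((x 1).1 : ℕ) : ZMod (2 * M))), (x 1).2) : TorusSite 1 (2 * M) × TorusSite 2 L)).1 * torusChar (p₁).2 ((((fun _ : Fin 1 => (((x 1).1 : ℕ) : ZMod (2 * M))), (x 1).2) : TorusSite 1 (2 * M) × TorusSite 2 L)).2) * (if p₀ = p₁ then f p₀ else 0) =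
      (torusChar (p₀).1 (-(((fun _ : Fin 1 => (((x 0).1 : ℕ) : ZMod (2 * M))), (x 0).2) : TorusSite 1 (2 * M) × TorusSite 2 L)).1 * torusChar (p₀).2 (-(((fun _ : Fin 1 => (((x 0).1 : ℕ) : ZMod (2 * M))), (x 0).2) : TorusSite 1 (2 * M) × TorusSite 2 L)).2) * (torusChar (p₀).1 ((((fun _ : Fin 1 => (((x 1).1 : ℕ) : ZMod (2 * M))), (x 1).2) : TorusSite 1 (2 * M) × TorusSite 2 L)).1 * torusChar (p₀).2 ((((fun _ : Fin 1 => (((x 1).1 : ℕ) : ZMod (2 * M))), (x 1).2) : TorusSite 1 (2 * M) × TorusSite 2 L)).2) * f p₀ := by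
    intro p₀
    simp_rw [eq_comm (a := p₀), mul_ite, mul_zero]
    rw [Finset.sum_ite_eq' univ p₀, if_pos (mem_univ _)]
  simp_rw [hin]
  refine sum_congr rfl fun Q _ => ?_
  rw [sub_eq_add_neg, pchar_add_right']
  ring

/-- **The two-leg plain pinned line of a conserving quadratic IS the `ℓ¹` norm of one character sum**:
`fixedTupleL1 L M β 1 (sectorisedKernel … trivialMultiplier 𝒱 2) ((0,σ i),![0,1] i) y = ε_x·‖κ‖·Σ_z ‖Σ_Q χ̄_Q(z)•f(Q)‖` (no volume factor:
one forced leg, one free leg). [cite: BenfattoGiulianiMastropietro2006, §2.3 (2.17)] -/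
theorem fixedTupleL1_two_eq_of_conserving {β : ℝ} (hβ : 0 < β) (𝒱 : HubbardGrassmann L M) (σ : Fin 2 → Fin 2) (κ : ℂ) (f : TorusSite 1 (2 * M) × TorusSite 2 L → ℂ)
    (hker : ∀ k : Fin 2 → FreqMomentum L M, kernel ℂ 𝒱 2 (fun i => ((k i, σ i), (![0, 1] : Fin 2 → Fin 2) i)) = κ * (if ((fun _ : Fin 1 => (((k 0).1 : ℕ) : ZMod (2 * M))), (k 0).2) = (((fun _ : Fin 1 => (((k 1).1 : ℕ) : ZMod (2 * M))), (k 1).2) : TorusSite 1 (2 * M) × TorusSite 2 L) then f ((fun _ : Fin 1 => (((k 0).1 : ℕ) : ZMod (2 * M))), (k 0).2) else 0))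
    (y : SpaceTimeIdx L M) :
    fixedTupleL1 L M β 1 (sectorisedKernel L M β (trivialMultiplier L M) 𝒱 2) (fun i : Fin 2 => ((((0 : Fin 1), σ i) : Fin 1 × Fin 2), (![0, 1] : Fin 2 → Fin 2) i)) y =
      imagTimeWeight β M * (‖κ‖ * ∑ z : TorusSite 1 (2 * M) × TorusSite 2 L, ‖∑ Q : TorusSite 1 (2 * M) × TorusSite 2 L, (torusChar Q.1 z.1 * torusChar Q.2 z.2) • f Q‖) := by
  classical
  have hβ0 : β ≠ 0 := hβ.ne'
  unfold fixedTupleL1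
  rw [pow_one]
  congr 1
  have hx : ∀ x : Fin 1 → SpaceTimeIdx L M,
      ‖sectorisedKernel L M β (trivialMultiplier L M) 𝒱 2 (fun i : Fin 2 => ((((0 : Fin 1), σ i) : Fin 1 × Fin 2), (![0, 1] : Fin 2 → Fin 2) i)) (Matrix.vecCons y x)‖ =
        ‖κ‖ * ‖∑ Q : TorusSite 1 (2 * M) × TorusSite 2 L, (torusChar Q.1 (((fun _ : Fin 1 => (((x 0).1 : ℕ) : ZMod (2 * M))), (x 0).2) - ((fun _ : Fin 1 => (((y).1 : ℕ) : ZMod (2 * M))), (y).2) : TorusSite 1 (2 * M) × TorusSite 2 L).1 * torusChar Q.2 (((fun _ : Fin 1 => (((x 0).1 : ℕ) : ZMod (2 * M))), (x 0).2) - ((fun _ : Fin 1 => (((y).1 : ℕ) : ZMod (2 * M))), (y).2) : TorusSite 1 (2 * M) × TorusSite 2 L).2) • f Q‖ := by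
    intro x
    rw [sectorisedKernel_def]
    rw [planeWaveSum_two_eq_charSum_of_conserving hβ0 σ _ κ f hker (Matrix.vecCons y x)]
    simp only [Matrix.cons_val_zero, Matrix.cons_val_one, norm_mul, Complex.norm_conj, Complex.norm_exp_ofReal_mul_I, one_mul, smul_eq_mul]
  simp_rw [hx]
  rw [← mul_sum, sum_tuple_one]
  congr 1
  -- `x ↦ x̄ − ȳ` runs over the product torus
  have h := sum_spaceTime_eq_sum_prodTorus
    (fun z : TorusSite 1 (2 * M) × TorusSite 2 L => ‖∑ Q : TorusSite 1 (2 * M) × TorusSite 2 L, (torusChar Q.1 (-z).1 * torusChar Q.2 (-z).2) * f Q‖) y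
  have hneg : ∀ w : SpaceTimeIdx L M, (((fun _ : Fin 1 => (((w).1 : ℕ) : ZMod (2 * M))), (w).2) - ((fun _ : Fin 1 => (((y).1 : ℕ) : ZMod (2 * M))), (y).2) : TorusSite 1 (2 * M) × TorusSite 2 L) = -((((fun _ : Fin 1 => (((y).1 : ℕ) : ZMod (2 * M))), (y).2) : TorusSite 1 (2 * M) × TorusSite 2 L) - ((fun _ : Fin 1 => (((w).1 : ℕ) : ZMod (2 * M))), (w).2)) := fun w => by rw [neg_sub]
  simp_rw [hneg]
  refine (h.trans ?_)
  -- `z ↦ −z` is a bijection of the torus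
  exact Fintype.sum_equiv (Equiv.neg _) _ _ fun z => rfl

end Summit.HubbardSuperconductivity.HubbardSuperconductivity.Theorems.TorusFourierL2

end
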